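import Literature.NumberTheory.IwasawaTheory.WeakLeopoldtCyclotomicLevels
import Literature.NumberTheory.GaloisRepresentations.ContinuousCohomologyTransport
import HarnessLib

/-!
# Weak Leopoldt for the cyclotomic tower, assembly II: descent from `K′(μ_{p^∞})` to `K′K^{cyc}_∞`
# and the named fact `weakLeopoldt_H2_subsingleton_cyclotomic_of_isOpen` FROM the finite-level
# killing statement «stagesDie» (NSW (10.3.25), proof; Serre I §2.4 Prop. 9)

Topic `NumberTheory/IwasawaTheory`; namespace `Literature.NumberTheory.IwasawaTheory`.  Theorems only
(no definition, no named fact, no instance; D-0026).  Sequel of `WeakLeopoldtCyclotomicLevels.lean`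
(width seat `bsd-line-x1-p1-w2` gen 7, cell `bsd-eis`, D-0154 (2) INPUTS lane).

* §3 `subsingleton_H2_above_cyclotomic_of_above_muInfty` — for `p` odd and `D ≃+ ℚ_p/ℤ_p` (trivial
  action): `H²(Gal(K_Σ/K′(μ_{p^∞})), D) = 0 ⟹ H²(Gal(K_Σ/K′K^{cyc}_∞), D) = 0`.  Inside
  `Gal(K_Σ/K′K^{cyc}_∞) = galoisGroupAbove S (U₀ ⊓ ker κ^{cyc})` the subgroup
  `Gal(K_Σ/K′(μ_{p^∞})) = galoisGroupAbove S (U₀ ⊓ ⋂ₖ ker χ̄_{p^k})` is the kernel of the descended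
  cyclotomic character, whose values there are torsion (`IsCyclotomic`), i.e. `(p−1)`-th roots of unity:
  an open normal subgroup of index prime to `p`, so restriction is injective on `H²` (the tree's
  `resSubgroup_two_injective`, `p − 1` being invertible on `ℚ_p/ℤ_p`).
* §4 **`weakLeopoldt_H2_subsingleton_cyclotomic_of_isOpen_of_stagesDie`** — the named fact
  `weakLeopoldt_H2_subsingleton_cyclotomic_of_isOpen` (`WeakLeopoldtCyclotomic.lean`; ⟺ (T4) of
  `Greenberg2006/GaloisCohomologyStructure.lean`) FOLLOWS from «stagesDie», the finite-level statement:
  for all `a ≤ k`, every finite `A ≤ D` killed by `p^a` and every continuous `2`-cocycle of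
  `Gal(K_Σ/K′(μ_{p^k}))` with values in `A` becomes, on a deeper stage `Gal(K_Σ/K′(μ_{p^{k'}}))` and read
  in `D`, a continuous coboundary.  («stagesDie» = the arithmetic of NSW (10.3.25): Brauer part killed on
  a cyclotomic layer — tree `GaloisCohomology.exists_resH_layerSubgroup_mu_primePow_eq_zero` —, `S`-class
  part killed by enlarging the coefficients — radical descent; typed by the sibling seats.)

HONEST FRAMING: conditional assembly; no case of weak Leopoldt is proved here.

References: [NeukirchSchmidtWingberg2008] (10.3.22), (10.3.25); [SerreGaloisCohomology1997] I §2.2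
Prop. 8, I §2.4 Prop. 9; [Serre1973] Ch. II §3; [Washington1997] §13.1; [NguyenQuangDo1984] Thm. 2.2.
-/

noncomputable section

open scoped Classical
open NumberField IsDedekindDomain Field
open Literature.NumberTheory.GaloisRepresentations
open Literature.NumberTheory.EllipticCurves (ZpExtension)
open Literature.NumberTheory.IwasawaTheory.Greenberg2006
open _root_.TopRep _root_.ContRepresentation _root_.ContinuousCohomology

namespace Literature.NumberTheory.IwasawaTheory

/-! ### §3. Descent from `K′(μ_{p^∞})` to `K′K^{cyc}_∞` (index prime to `p`; Serre I §2.4 Prop. 9) -/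

section Descent

variable {K : Type} [Field K] [NumberField K] (p : ℕ) [hp : Fact p.Prime]
  (S : Set (HeightOneSpectrum (𝓞 K)))

/-- `ker χ_p = ⋂ₖ ker χ̄_{p^k}`: an automorphism with trivial `p`-adic cyclotomic character fixes every
`p`-power root of unity. [cite: Washington1997, §13.1] -/
theorem mem_iInf_ker_modNCyclotomicCharacter_of_cyclotomicCharacter_eq_one
    {σ : absoluteGaloisGroup K} (hσ : GaloisRep.cyclotomicCharacter K p σ = 1) :
    σ ∈ ⨅ k : ℕ, (modNCyclotomicCharacter K (p ^ k)).ker := by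
  rw [Subgroup.mem_iInf]
  intro k
  obtain ⟨ζ, hζ⟩ := HasEnoughRootsOfUnity.exists_primitiveRoot (AlgebraicClosure K) (p ^ k)
  have hfix : σ • ζ = ζ := by
    have h := GaloisRep.cyclotomicCharacter_spec K p (k := k) σ ζ hζ.pow_eq_one
    rw [hσ, Units.val_one, map_one] at h
    rcases Nat.lt_or_ge 1 (p ^ k) with h1 | h1
    · haveI : Fact (1 < p ^ k) := ⟨h1⟩
      rwa [ZMod.val_one, pow_one] at h
    · have hk : p ^ k = 1 := le_antisymm h1 (Nat.one_le_pow _ _ hp.out.pos)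
      have hζ1 : ζ = 1 := by
        have := hζ.pow_eq_one
        rwa [hk, pow_one] at this
      rw [hζ1, smul_one]
  rw [MonoidHom.mem_ker]
  ext
  rw [Units.val_one, ← Nat.cast_one]
  exact modNCyclotomicCharacter_eq_of_smul_eq_pow K (p ^ k) hζ σ (by rw [pow_one]; exact hfix)

/-- The torsion of `ℤ_pˣ` is killed by `p − 1` for odd `p` (`(ℤ_pˣ)_{tors} = μ_{p−1}`).
[cite: Serre1973, Ch. II §3.1 Prop. 7, §3.2 Prop. 8] -/
theorem pow_sub_one_eq_one_of_mem_torsion (hp2 : p ≠ 2) {u : ℤ_[p]ˣ}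
    (hu : u ∈ CommGroup.torsion ℤ_[p]ˣ) : u ^ (p - 1) = 1 := by
  have h := Literature.NumberTheory.EllipticCurves.PadicInt.torsion_units_le_rootsOfUnity (p := p) hu
  have ht : Literature.NumberTheory.EllipticCurves.torsionOrder p = p - 1 := by
    rw [Literature.NumberTheory.EllipticCurves.torsionOrder,
      Literature.NumberTheory.EllipticCurves.cyclotomicExponent, if_neg hp2, pow_one,
      Nat.totient_prime hp.out]
  rw [ht] at h
  exact (mem_rootsOfUnity _ _).mp h

/-- Multiplication by an integer prime to `p` is bijective on a group `≃+ ℚ_p/ℤ_p`. [folklore] -/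
private theorem bijective_zsmul_of_coprime_of_addEquiv {D : Type} [AddCommGroup D]
    (e : D ≃+ ℚ_[p] ⧸ (PadicInt.subring p).toAddSubgroup) {d : ℕ} (hd : Nat.Coprime d p) :
    Function.Bijective fun m : D ↦ (d : ℤ) • m := by
  let e' : D ≃+ QpModZp p := e.trans (QpModZp.addEquivQuotientSubring p).symm
  have hb := bijective_zsmul_of_coprime (A := QpModZp p) hd
  have hcomm : (fun m : D ↦ (d : ℤ) • m) = e'.symm ∘ (fun m : QpModZp p ↦ (d : ℤ) • m) ∘ e' := by
    funext m
    simp only [Function.comp_apply, map_zsmul, AddEquiv.symm_apply_apply]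
  rw [hcomm]
  exact e'.symm.bijective.comp (hb.comp e'.bijective)

/-- **Descent from `K′(μ_{p^∞})` to `K′K^{cyc}_∞`** (`p` odd, `D ≃ ℚ_p/ℤ_p` with the trivial action):
`H²(Gal(K_Σ/K′(μ_{p^∞})), D) = 0 ⟹ H²(Gal(K_Σ/K′K^{cyc}_∞), D) = 0`.  Indeed
`Gal(K_Σ/K′(μ_{p^∞})) = galoisGroupAbove S (U₀ ⊓ ker χ_p)` is the kernel, inside
`Gal(K_Σ/K′K^{cyc}_∞) = galoisGroupAbove S (U₀ ⊓ ker κ^{cyc})`, of the character `χ_p`, whose values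
there are torsion (`IsCyclotomic`), i.e. `(p−1)`-th roots of unity: an open normal subgroup of index
prime to `p`, so restriction is injective on `H²` (Serre I §2.4 Prop. 9 in degree `2`, the tree's
`resSubgroup_two_injective`, `p − 1` being invertible on `ℚ_p/ℤ_p`).
[cite: SerreGaloisCohomology1997, I §2.4 Prop. 9 and Corollaire] [cite: NeukirchSchmidtWingberg2008, (10.3.25) (proof)]
[cite: Washington1997, §13.1] -/
theorem subsingleton_H2_above_cyclotomic_of_above_muInfty (hp2 : p ≠ 2)
    (hS : ∀ v : HeightOneSpectrum (𝓞 K), ((p : ℕ) : 𝓞 K) ∈ v.asIdeal → v ∈ S)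
    {κ : ZpExtension K p} (hκ : κ.IsCyclotomic)
    (U₀ : Subgroup (absoluteGaloisGroup K)) (hU₀ : IsOpen (U₀ : Set (absoluteGaloisGroup K)))
    {R : Type} [CommRing R] [TopologicalSpace R]
    {D : Type} [AddCommGroup D] [Module R D] [TopologicalSpace D] [DiscreteTopology D]
    [ContinuousSMul R D] (hD : Nonempty (D ≃+ ℚ_[p] ⧸ (PadicInt.subring p).toAddSubgroup))
    (h : Subsingleton (continuousCohomology 2 (ContinuousRep.trivial
      (galoisGroupAbove S (U₀ ⊓ ⨅ k : ℕ, (modNCyclotomicCharacter K (p ^ k)).ker)) R D).toTopRep)) :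
    Subsingleton (continuousCohomology 2 (ContinuousRep.trivial
      (galoisGroupAbove S (U₀ ⊓ κ.kerSubgroup)) R D).toTopRep) := by
  classical
  obtain ⟨eD⟩ := hD
  haveI : TotallyDisconnectedSpace (GaloisGroupUnramifiedOutside K S) :=
    totallyDisconnectedSpace_galoisGroupUnramifiedOutside S
  -- notation
  set Finf : Subgroup (absoluteGaloisGroup K) := ⨅ k : ℕ, (modNCyclotomicCharacter K (p ^ k)).ker
    with hFinf
  set Γ₀ : Subgroup (GaloisGroupUnramifiedOutside K S) := galoisGroupAbove S (U₀ ⊓ κ.kerSubgroup)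
    with hΓ₀
  set Γ₁ : Subgroup (GaloisGroupUnramifiedOutside K S) := galoisGroupAbove S (U₀ ⊓ Finf) with hΓ₁
  -- `⋂ₖ ker χ̄_{p^k} ≤ ker κ`, so `Γ₁ ≤ Γ₀`
  have hFle : Finf ≤ κ.kerSubgroup := iInf_ker_modNCyclotomicCharacter_le_kerSubgroup p hκ
  have hle : Γ₁ ≤ Γ₀ := Subgroup.map_mono (inf_le_inf_left U₀ hFle)
  -- `N_S ≤` everything
  have hNF : ramificationSubgroup K S ≤ Finf :=
    le_iInf fun k ↦ ramificationSubgroup_le_ker_modNCyclotomicCharacter p S hS k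
  have hNχ : ramificationSubgroup K S ≤ (GaloisRep.cyclotomicCharacter K p).toMonoidHom.ker := by
    intro σ hσ
    rw [MonoidHom.mem_ker]
    have h1 := hNF hσ
    rw [hFinf, Subgroup.mem_iInf] at h1
    change GaloisRep.cyclotomicCharacter K p σ = 1
    rw [GaloisRep.cyclotomicCharacter_apply]
    exact cyclotomicCharacter_eq_one_of_forall_pow_eq_one p _ fun n t ht ↦
      smul_eq_self_of_mem_ker_modNCyclotomicCharacter p (h1 n) ht
  -- the cyclotomic character descends to `G_{K,S}` and restricts to `Γ₀`
  let χbar : GaloisGroupUnramifiedOutside K S →* ℤ_[p]ˣ :=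
    QuotientGroup.lift _ (GaloisRep.cyclotomicCharacter K p).toMonoidHom hNχ
  have hχbar : ∀ σ : absoluteGaloisGroup K, χbar (toUnramifiedQuot K S σ) =
      GaloisRep.cyclotomicCharacter K p σ := fun σ ↦ QuotientGroup.lift_mk' _ _ σ
  let θ : Γ₀ →* ℤ_[p]ˣ := χbar.comp Γ₀.subtype
  -- its kernel is `Γ₁` (viewed inside `Γ₀`)
  have hker : θ.ker = Γ₁.subgroupOf Γ₀ := by
    ext g
    obtain ⟨g, hg⟩ := g
    rw [MonoidHom.mem_ker, Subgroup.mem_subgroupOf]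
    obtain ⟨σ, hσ, rfl⟩ := (mem_galoisGroupAbove_iff S _ _).mp hg
    change χbar (toUnramifiedQuot K S σ) = 1 ↔ toUnramifiedQuot K S σ ∈ Γ₁
    rw [hχbar]
    constructor
    · intro h1
      exact (mem_galoisGroupAbove_iff S _ _).mpr ⟨σ, Subgroup.mem_inf.mpr
        ⟨(Subgroup.mem_inf.mp hσ).1,
          mem_iInf_ker_modNCyclotomicCharacter_of_cyclotomicCharacter_eq_one p h1⟩, rfl⟩
    · intro h1
      obtain ⟨τ, hτ, hτσ⟩ := (mem_galoisGroupAbove_iff S _ _).mp h1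
      have h2 : toUnramifiedQuot K S (τ⁻¹ * σ) = 1 := by
        rw [map_mul, map_inv, hτσ, inv_mul_cancel]
      have h3 : τ⁻¹ * σ ∈ ramificationSubgroup K S := (QuotientGroup.eq_one_iff _).mp h2
      have h4 : σ ∈ Finf := by
        simpa using Finf.mul_mem (Subgroup.mem_inf.mp hτ).2 (hNF h3)
      rw [hFinf, Subgroup.mem_iInf] at h4
      rw [GaloisRep.cyclotomicCharacter_apply]
      exact cyclotomicCharacter_eq_one_of_forall_pow_eq_one p _ fun n t ht ↦
        smul_eq_self_of_mem_ker_modNCyclotomicCharacter p (h4 n) ht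
  -- its values are `(p-1)`-th roots of unity: `σ ∈ ker κ` has torsion `χ_p(σ)`
  have hθpow : ∀ g : Γ₀, θ g ^ (p - 1) = 1 := by
    rintro ⟨g, hg⟩
    obtain ⟨σ, hσ, rfl⟩ := (mem_galoisGroupAbove_iff S _ _).mp hg
    change χbar (toUnramifiedQuot K S σ) ^ (p - 1) = 1
    rw [hχbar]
    refine pow_sub_one_eq_one_of_mem_torsion p hp2 ?_
    have hκ' : κ.kerSubgroup = (CommGroup.torsion ℤ_[p]ˣ).comap
        (GaloisRep.cyclotomicCharacter K p).toMonoidHom := hκ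
    have hσ2 := (Subgroup.mem_inf.mp hσ).2
    rw [hκ', Subgroup.mem_comap] at hσ2
    exact hσ2
  -- hence `θ.ker` is a normal subgroup of `Γ₀` of finite index prime to `p`
  set N₀ : Subgroup Γ₀ := θ.ker with hN₀
  haveI : N₀.Normal := by rw [hN₀]; infer_instance
  have hp1 : 0 < p - 1 := Nat.sub_pos_of_lt hp.out.one_lt
  have hpdvd : ¬ p ∣ p - 1 := fun hd ↦ by
    have := Nat.le_of_dvd hp1 hd
    omega
  have hcop : Nat.Coprime N₀.index p := by
    rw [hN₀, Subgroup.index_ker]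
    exact coprime_card_range_of_pow_eq_one θ hp1 hpdvd hθpow
  -- topology: `Γ₀` is profinite, `N₀` is closed of finite index, hence open
  haveI hΓ₀cpt : CompactSpace Γ₀ := compactSpace_galoisGroupAbove S _
    ((Subgroup.isClosed_of_isOpen U₀ hU₀).inter κ.isClosed_kerSubgroup)
  have hFcl : IsClosed ((Finf : Subgroup (absoluteGaloisGroup K)) : Set (absoluteGaloisGroup K)) := by
    rw [hFinf, Subgroup.coe_iInf]
    exact isClosed_iInter fun k ↦ Subgroup.isClosed_of_isOpen _ (isOpen_ker_modNCyclotomicCharacter p k)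
  have hΓ₁cl : IsClosed ((Γ₁ : Subgroup (GaloisGroupUnramifiedOutside K S)) :
      Set (GaloisGroupUnramifiedOutside K S)) :=
    isClosed_galoisGroupAbove S _ ((Subgroup.isClosed_of_isOpen U₀ hU₀).inter hFcl)
  have hN₀cl : IsClosed ((N₀ : Subgroup Γ₀) : Set Γ₀) := by
    have : ((N₀ : Subgroup Γ₀) : Set Γ₀) = Subtype.val ⁻¹' (Γ₁ : Set (GaloisGroupUnramifiedOutside K S)) := by
      ext g
      have hg := SetLike.ext_iff.mp hker g
      rw [Subgroup.mem_subgroupOf] at hg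
      exact hg
    rw [this]
    exact hΓ₁cl.preimage continuous_subtype_val
  haveI : N₀.FiniteIndex := ⟨fun h0 ↦ by
    rw [h0, Nat.coprime_zero_left] at hcop
    exact hp.out.one_lt.ne' hcop⟩
  have hN₀open : IsOpen ((N₀ : Subgroup Γ₀) : Set Γ₀) := Subgroup.isOpen_of_isClosed_of_finiteIndex _ hN₀cl
  haveI : Fintype (Γ₀ ⧸ N₀) := Subgroup.fintypeQuotientOfFiniteIndex
  -- `N₀ ≃ₜ* Γ₁`
  let e₀ : N₀ ≃* Γ₁ := (MulEquiv.subgroupCongr hker).trans (Subgroup.subgroupOfEquivOfLe hle)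
  have he₀ : ∀ u : N₀, ((e₀ u : Γ₁) : GaloisGroupUnramifiedOutside K S) =
      ((u : Γ₀) : GaloisGroupUnramifiedOutside K S) := fun _ ↦ rfl
  have he₀' : ∀ v : Γ₁, (((e₀.symm v : N₀) : Γ₀) : GaloisGroupUnramifiedOutside K S) =
      (v : GaloisGroupUnramifiedOutside K S) := fun _ ↦ rfl
  let e : N₀ ≃ₜ* Γ₁ :=
    { e₀ with
      continuous_toFun := by
        refine Topology.IsInducing.subtypeVal.continuous_iff.mpr ?_
        show Continuous fun u : N₀ ↦ ((e₀ u : Γ₁) : GaloisGroupUnramifiedOutside K S)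
        simp_rw [he₀]
        exact continuous_subtype_val.comp continuous_subtype_val
      continuous_invFun := by
        refine Topology.IsInducing.subtypeVal.continuous_iff.mpr
          (Topology.IsInducing.subtypeVal.continuous_iff.mpr ?_)
        show Continuous fun v : Γ₁ ↦ (((e₀.symm v : N₀) : Γ₀) : GaloisGroupUnramifiedOutside K S)
        simp_rw [he₀']
        exact continuous_subtype_val }
  -- the vanishing on `Γ₁` (over `ℤ`), transported to `N₀`
  have hΓ₁Z : Subsingleton (continuousCohomology 2 (ContinuousRep.trivial Γ₁ ℤ D).toTopRep) :=
    subsingleton_H2_trivial_of_ring h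
  have hN₀Z : Subsingleton (continuousCohomology 2 (ContinuousRep.trivial N₀ ℤ D).toTopRep) := by
    haveI := hΓ₁Z
    exact subsingleton_continuousCohomology_of_continuousMulEquiv e
      (X := (ContinuousRep.trivial N₀ ℤ D).toTopRep)
      (Y := (ContinuousRep.trivial Γ₁ ℤ D).toTopRep)
      (TopRep.ofHom ⟨ContinuousLinearMap.id ℤ D, fun _ ↦ rfl⟩)
      (TopRep.ofHom ⟨ContinuousLinearMap.id ℤ D, fun _ ↦ rfl⟩)
      (fun _ ↦ rfl) 2
  -- Serre I §2.4 Prop. 9 in degree 2: `res : H²(Γ₀, D) → H²(N₀, D)` is injective over `ℤ`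
  set ρZ : ContinuousRep Γ₀ ℤ D := ContinuousRep.trivial Γ₀ ℤ D with hρZ
  have hinj := resSubgroup_two_injective N₀ ρZ hN₀open
    (bijective_zsmul_of_coprime_of_addEquiv p eD hcop)
  haveI : Subsingleton (continuousCohomology 2 (subgroupRep ρZ.toTopRep N₀)) := by
    change Subsingleton (continuousCohomology 2
      ((ρZ.restrict ⟨N₀.subtype, continuous_subtype_val⟩).toTopRep))
    exact hN₀Z
  have hZ : Subsingleton (continuousCohomology 2 ρZ.toTopRep) := hinj.subsingleton
  exact subsingleton_H2_trivial_of_ring hZ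

end Descent

/-! ### §4. The named fact `weakLeopoldt_H2_subsingleton_cyclotomic_of_isOpen` FROM «stagesDie» -/

section Final

/-- **Cyclotomic weak Leopoldt (`WeakLeopoldtCyclotomic.lean`, = (T4) by
`Summits/…/EisensteinPrimesGoodLatticeBDPValueT4OfCyclotomic`) FOLLOWS from the finite-level killing
statement «stagesDie»** — the hypothesis below, quantified over the data of the named fact: for a
number field `K`, an odd prime `p`, a finite `S ⊇ {v ∣ p}`, an open `U₀ ≥ N_S` and a discrete
`D ≃+ ℚ_p/ℤ_p`: for all `a ≤ k`, every finite subgroup `A ≤ D` killed by `p^a` and every continuous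
`2`-cocycle of `Gal(K_Σ/K′(μ_{p^k})) = galoisGroupAbove S (U₀ ⊓ ker χ̄_{p^k})` with values in `A`
(trivial action, over `ℤ`) becomes, on some deeper stage `Gal(K_Σ/K′(μ_{p^{k'}}))` and read in `D`, the
coboundary of a continuous `1`-cochain.  («stagesDie» is what the arithmetic of NSW (10.3.25) proves:
the Brauer part of such a class dies on a deeper cyclotomic layer — tree
`GaloisCohomology.exists_resH_layerSubgroup_mu_primePow_eq_zero` — and the `S`-ideal-class part dies
after enlarging `μ_{p^a}` by the `p`-part of the `S`-class number, by radical descent.)  Assembly: §2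
(limit over the levels `K′(μ_{p^k})`, Serre I §2.2 Prop. 8) + §3 (descent from `K′(μ_{p^∞})` to
`K′K^{cyc}_∞`, index prime to `p`, Serre I §2.4 Prop. 9).
[cite: NeukirchSchmidtWingberg2008, (10.3.25) with (10.3.22)] [cite: SerreGaloisCohomology1997, I §2.2 Prop. 8, I §2.4 Prop. 9]
[cite: NguyenQuangDo1984, Thm. 2.2] -/
theorem weakLeopoldt_H2_subsingleton_cyclotomic_of_isOpen_of_stagesDie
    (hdie : ∀ (K : Type) [Field K] [NumberField K] (p : ℕ) [Fact p.Prime], p ≠ 2 →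
      ∀ (S : Set (HeightOneSpectrum (𝓞 K))), S.Finite →
        (∀ v : HeightOneSpectrum (𝓞 K), ((p : ℕ) : 𝓞 K) ∈ v.asIdeal → v ∈ S) →
      ∀ (U₀ : Subgroup (absoluteGaloisGroup K)),
        IsOpen (U₀ : Set (absoluteGaloisGroup K)) → ramificationSubgroup K S ≤ U₀ →
      ∀ (D : Type) [AddCommGroup D] [TopologicalSpace D] [DiscreteTopology D],
        Nonempty (D ≃+ ℚ_[p] ⧸ (PadicInt.subring p).toAddSubgroup) →
      ∀ (k a : ℕ), a ≤ k → ∀ (A : AddSubgroup D) [Finite A], (∀ x ∈ A, p ^ a • x = 0) →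
      ∀ c : contTwoCocycles (((ContinuousRep.trivial (GaloisGroupUnramifiedOutside K S) ℤ A).restrict
          (subgroupIncl (galoisGroupAbove S (U₀ ⊓ (modNCyclotomicCharacter K (p ^ k)).ker)))).toTopRep),
      ∃ (k' : ℕ) (hkk' : k ≤ k')
        (b : C(galoisGroupAbove S (U₀ ⊓ (modNCyclotomicCharacter K (p ^ k')).ker), D)),
        ∀ σ τ : galoisGroupAbove S (U₀ ⊓ (modNCyclotomicCharacter K (p ^ k')).ker),
          ((c.1 (Subgroup.inclusion
              (galoisGroupAbove_inf_ker_modNCyclotomicCharacter_antitone p S U₀ hkk') σ,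
            Subgroup.inclusion
              (galoisGroupAbove_inf_ker_modNCyclotomicCharacter_antitone p S U₀ hkk') τ) : A) : D) =
            b τ - b (σ * τ) + b σ) :
    weakLeopoldt_H2_subsingleton_cyclotomic_of_isOpen := by
  intro K _ _ p _ hp S hSf hS κ hκ U₀ hU₀ hN R _ _ _ D _ _ _ _ _ hD
  -- `D ≃ ℚ_p/ℤ_p` is `p`-primary torsion
  have hptors : ∀ x : D, ∃ n : ℕ, p ^ n • x = 0 := fun x ↦ by
    obtain ⟨e⟩ := hD
    set y : QpModZp p := (QpModZp.addEquivQuotientSubring p).symm (e x) with hy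
    obtain ⟨n, hn⟩ := QpModZp.exists_pow_nsmul_eq_zero (p := p) y
    refine ⟨n, e.injective ((QpModZp.addEquivQuotientSubring p).symm.injective ?_)⟩
    rw [map_nsmul, map_nsmul, ← hy, hn, map_zero, map_zero]
  have h1 := subsingleton_H2_above_muInfty_of_stagesDie p S hS U₀ hU₀ hN (R := R) (D := D) hptors
    (hdie K p hp S hSf hS U₀ hU₀ hN D hD)
  exact subsingleton_H2_above_cyclotomic_of_above_muInfty p S hp hS hκ U₀ hU₀ hD h1

end Final

end Literature.NumberTheory.IwasawaTheory

end
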